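import Summits.ABC.ABC.Theorems.PadicPrincipalCoreST86Assembly
import Summits.ABC.ABC.Theorems.PadicPrincipalCoreST86TheoremA
import Summits.ABC.ABC.Theorems.PadicPrincipalCoreST86Glue
import Summits.ABC.ABC.Theorems.PadicPrincipalCoreST86OddShape
import Summits.ABC.StewartYu.PadicLogFormsPrincipalReduction
import HarnessLib

/-!
# Rung A1.M1 by name: Stewart–Tijdeman 1986 (`log c ≤ κ · rad(abc)^{15}`) — UNCONDITIONAL

`Summits/ABC/ABC/Theorems/StewartTijdeman1986Holds.lean` — cell `abc-stewartyu` (planner g6 WANTED 12:11Z,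
filed by p3-g3).  The five items of route `PadicPrincipalCoreST86` are landed theorems: `TheoremA`
(`padicPrincipalCoreST86_theoremA_proof`, the `p`-adic principal-core machine on the Cijsouw–Waldschmidt /
Waldschmidt-1980 architecture), `WPM` (`Summit.ABC.StewartYu.PrincipalLattice.exists_principal_generators`,
p1's principal-generator reduction), `GlueSpec` (`padicPrincipalCoreST86_glueSpec_proof`), `OddShapeSpec`
(`padicPrincipalCoreST86_oddShapeSpec_proof`) and `Assembly` (`padicPrincipalCoreST86_assembly_proof` = the
route's `closes`); composing them gives the rung leaf `Literature.Barriers.ABC.stewartTijdeman1986_upperBound`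
as a BY-NAME tree theorem, so that the route can be ledger-closed against its target.  [folklore] assembly.
-/

set_option linter.dupNamespace false

namespace Summit.ABC.ABC.Theorems

/-- **Rung A1.M1 — the Stewart–Tijdeman 1986 upper bound holds**: there is `κ` with
`log c ≤ κ · rad(abc)^{15}` for all `abc`-triples (the leaf
`Literature.Barriers.ABC.stewartTijdeman1986_upperBound`), by the `p`-adic principal-core machine at every
odd prime, the principal-generator reduction, the glue and the odd socket. [cite: StewartTijdeman1986,
Theorem 1 (upper bound), as quoted in Waldschmidt2014 §2] -/
theorem stewartTijdeman1986_holds : Literature.Barriers.ABC.stewartTijdeman1986_upperBound :=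
  padicPrincipalCoreST86_assembly_proof padicPrincipalCoreST86_theoremA_proof
    Summit.ABC.StewartYu.PrincipalLattice.exists_principal_generators
    padicPrincipalCoreST86_glueSpec_proof padicPrincipalCoreST86_oddShapeSpec_proof

end Summit.ABC.ABC.Theorems
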